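import Literature.Geometry.DiscreteGeometry.TriangularLatticeAnimals
import Literature.Geometry.DiscreteGeometry.HeitmannRadinSpiral
import HarnessLib

/-!
# Erosion by hexagons and a discrete Bonnesen inequality on the triangular lattice

Topic `Literature/Geometry/DiscreteGeometry`; companion of `TriangularLatticeAnimals.lean`
(`IsRowConvex`, `bondCount`, `triCount`), `TriangularLatticeContactBound.lean` (Harborth's bound and
the row-convexity of its extremisers) and `HexagonalSpiral.lean` / `HeitmannRadinSpiral.lean`
(`hexagon t`, `rot6`).  Cell `crystal3d-full`, literature-typing layer D-0088 (4), seat `littype-FC1-1`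
(gen 10).  Everything below is a theorem about finite label sets `S ⊂ ℤ²` of the triangular lattice
`A₂` (labels `(m, n) ↦ m t₁ + n t₂`); the file introduces no named facts.

## The result and its source

E. Davoli, P. Piovano, U. Stefanelli, *Sharp `N^{3/4}` law for the minimizers of the
edge-isoperimetric problem on the triangular lattice*, J. Nonlinear Sci. **27** (2017) 627–660
[DavoliPiovanoStefanelli2017], §3 "Maximal hexagons associated to EIP minimizers", proves for every
minimizer `M_n` of the edge-isoperimetric problem with maximal inscribed lattice hexagon of radius
`r = r_{M_n}` ((54)–(55) p. 641) the quadratic inequality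

  (71) (p. 652)  `3r² − (p_n − 9) r + n − 2 p_n ≤ 0`,  `p_n = θ_n/2 − 3 = ⌈√(12n − 3)⌉ − 3`,

from which Proposition 3.7 (69) (the lower bound on `r_{M_n}`, the core of the `N^{3/4}` law
Theorem 1.2 and of Corollary 1.3) is obtained by solving for `r`.  The printed route to (71) is the
region bookkeeping (59)–(68) (levels `λ_k`, good polygons `P_k`, bad polygons `T_k`,
Proposition 3.5, Lemma 3.6).

THIS FILE PROVES A SHARPER FORM OF (71) BY A DIFFERENT, SHORTER ARGUMENT — a discrete version of
Bonnesen's inradius inequality `A ≤ P r − π r²` via inner parallel sets — valid for EVERY finite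
label set that is *3-convex* (each lattice line, in each of the three directions, meets it in an
interval; EIP minimizers are 3-convex, [DavoliPiovanoStefanelli2017, Proposition 3.3], in the tree
`isRowConvex_of_adjCount_eq` + `rot6`):

  **`hexagonal Bonnesen inequality`** (`card_add_sq_le_lineCount`):
  `n + 3 (r + 1)² ≤ (r + 1) · L(S) + 1`,

where `n = #S`, `r` is the largest `t` with a translate of the hexagon `H_t` inside `S`, and
`L(S)` is the number of lattice lines (rows in the three directions) meeting `S`.  For an EIP
minimizer `L(S) = 3n − b = ⌈√(12n − 3)⌉ = p_n + 3` (`bondCount_add_lineCount`), and the inequality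
reads `n ≤ −3r² + (p_n − 3) r + p_n + 1`, which implies (71) whenever `p_n ≥ 6r + 1` (and (69) in all
cases — `TriangularLatticeMaximalHexagon.lean`).  Equality holds for the full hexagons `H_s`
(`n = 3s² + 3s + 1`, `r = s`, `L = 6s + 3`).  (Remark: (71) as printed fails for `M_n = H_s` itself —
there `Λ := p_n − 6r = 0` and (66) would give `|𝓗| ≥ 4 > 0`; the statement (69) is unaffected.)

## The proof formalised here (ours)

Write `S ⊖ H_t := {z : z + H_t ⊆ S}` (`erodeN S t`), `L(T)`-layer `∂T := {z ∈ T : some lattice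
neighbour of z is not in T}` (`bdLayer T`), so that `T ⊖ H₁ = T ∖ ∂T` and, by the geodesic
decomposition `H_{t+1} = H_t ∪ ⋃_{|e|=1} (e + H_t)` (`mem_hexagon_succ_iff`),
`S ⊖ H_{t+1} = (S ⊖ H_t) ⊖ H₁` (`erodeN_succ`).  Hence `n = Σ_{t=0}^{r} #∂(S ⊖ H_t)`.
* (lines) `L(T ⊖ H₁) + 6 ≤ L(T)` when `T ⊖ H₁ ≠ ∅` — in each direction the two extreme occupied
  lines are lost (`lineCount_erode_add_six_le`); so `L(S ⊖ H_t) ≤ L(S) − 6t`.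
* (convexity) erosion preserves 3-convexity (`isTriConvex_erode`).
* (layer bound) for non-empty 3-convex `T`: `#∂T + 3 ≤ L(T) + [#T = 1]` (`card_bdLayer_add_three_le`).
  Proof: CHARGING — with `d(z)` the number of neighbours of `z` in `T` and `w(z)` the number of unit
  triangles of `T` at `z`, `w(z) + [0 < d(z) < 6] ≤ d(z) + [d(z) = 0]` (a fact about subsets of `ℤ/6`),
  and `Σ d = 2b`, `Σ w = 3A` (`sum_wedges_eq`), so `3A + #{0 < d < 6} ≤ 2b + #{d = 0}`; EULER —
  `b + Z ≤ A + n` for row-convex `T`, `Z` the number of occupied rows without a bond upwards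
  (`bondCount_add_card_filter_rowBonds_eq_zero_le`, `TriangularLatticeAnimals.lean`), and
  `Z ≥ #{d = 0} + [∃ z, d(z) > 0]`; LINES — `b + L(T) = 3n` (`bondCount_add_lineCount`).
* Summing: `n + Σ_{t ≤ r} (6t + 3) ≤ (r + 1) L(S) + 1`, i.e. the inequality (only `S ⊖ H_r`, the last
  non-empty erosion, can be a single label).

## Contents (namespace `Literature.Geometry.DiscreteGeometry.HarborthSpiral`)

§1 hexagons: `zero_mem_hexagon'`, `hexagon_mono`, `add_mem_hexagon_succ`, `exists_step_mem_hexagon`,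
`mem_hexagon_succ_iff`.  §2 `erode`, `erodeN`, `bdLayer` with `mem_*`, `erodeN_zero`, `erodeN_succ`,
`card_eq_card_erode_add_card_bdLayer`, `erode_image_rot6`, `erodeN_image_rot6`,
`lt_card_of_erodeN_nonempty`, `exists_maxRadius`.  §3 `lineCount`, `card_rows_erode_add_two_le`,
`lineCount_erode_add_six_le`, `lineCount_erodeN_add_le`.  §4 `IsTriConvex`, `isRowConvex_erode`,
`isTriConvex_erode(N)`, `horizBonds_image_rot6`, `diagBonds_image_rot6`, `bondCount_add_lineCount`.
§5 `wedges`, `sum_wedges_eq` (`= 3 · triCount`), `wedges_add_le` (charging), `card_bdLayer_add_three_le`.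
§6 `card_add_sq_le_lineCount` (the inequality), `card_sub_le_of_isTriConvex` (`n − #H_r ≤ (r+1)(L − 6r − 3)`)
and `six_mul_add_three_le_lineCount` (`L ≥ 6r + 3`).
-/

noncomputable section

namespace Literature.Geometry.DiscreteGeometry

open Finset

namespace HarborthSpiral

/-! ## §1 Hexagons: monotonicity and one geodesic step -/

/-- `0 ∈ H_t`. [cite: HeitmannRadin1980, §3 (p. 283)] -/
theorem zero_mem_hexagon' (t : ℕ) : (0 : ℤ × ℤ) ∈ hexagon t := by
  rw [mem_hexagon]
  unfold Inside
  simp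

/-- `H_s ⊆ H_t` for `s ≤ t`. [cite: HeitmannRadin1980, §3 (p. 283)] -/
theorem hexagon_mono {s t : ℕ} (h : s ≤ t) : hexagon s ⊆ hexagon t := by
  intro q hq
  have hst : (s : ℤ) ≤ t := by exact_mod_cast h
  rw [mem_hexagon] at hq ⊢
  unfold Inside at hq ⊢
  omega

/-- A unit step moves a point of `H_t` into `H_{t+1}` (`e + H_t ⊆ H_{t+1}` for `|e| = 1`).
[cite: DavoliPiovanoStefanelli2017, (54) p. 641] -/
theorem add_mem_hexagon_succ {t : ℕ} {u e : ℤ × ℤ} (hu : u ∈ hexagon t) (he : normForm e = 1) :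
    e + u ∈ hexagon (t + 1) := by
  obtain ⟨a, b⟩ := e
  obtain ⟨x, y⟩ := u
  rw [mem_hexagon] at hu ⊢
  unfold Inside at hu ⊢
  rw [normForm_eq_one_iff] at he
  simp only [Prod.mk_add_mk] at hu ⊢
  push_cast
  rcases he with ⟨rfl, rfl⟩ | ⟨rfl, rfl⟩ | ⟨rfl, rfl⟩ | ⟨rfl, rfl⟩ | ⟨rfl, rfl⟩ | ⟨rfl, rfl⟩ <;> omega

/-- **One geodesic step towards the centre.** A point of `H_{t+1}` outside `H_t` is one unit step
away from `H_t` (the hexagonal norm `max(|m|, |n|, |m+n|)` is the graph distance of `A₂`).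
[cite: DavoliPiovanoStefanelli2017, (54)–(55) p. 641] -/
theorem exists_step_mem_hexagon {t : ℕ} {w : ℤ × ℤ} (hw : w ∈ hexagon (t + 1))
    (hw' : w ∉ hexagon t) : ∃ e : ℤ × ℤ, normForm e = 1 ∧ w - e ∈ hexagon t := by
  obtain ⟨x, y⟩ := w
  rw [mem_hexagon] at hw hw'
  unfold Inside at hw hw'
  simp only at hw hw'
  push_cast at hw hw'
  by_cases h0 : 1 ≤ x ∧ 0 ≤ y
  · refine ⟨(1, 0), by simp [normForm], ?_⟩
    rw [mem_hexagon, Prod.mk_sub_mk]; unfold Inside; simp only; omega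
  by_cases h1 : x ≤ 0 ∧ 1 ≤ x + y
  · refine ⟨(0, 1), by simp [normForm], ?_⟩
    rw [mem_hexagon, Prod.mk_sub_mk]; unfold Inside; simp only; omega
  by_cases h2 : x + y ≤ 0 ∧ 1 ≤ y
  · refine ⟨(-1, 1), by simp [normForm], ?_⟩
    rw [mem_hexagon, Prod.mk_sub_mk]; unfold Inside; simp only; omega
  by_cases h3 : x ≤ -1 ∧ y ≤ 0
  · refine ⟨(-1, 0), by simp [normForm], ?_⟩
    rw [mem_hexagon, Prod.mk_sub_mk]; unfold Inside; simp only; omega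
  by_cases h4 : 0 ≤ x ∧ x + y ≤ -1
  · refine ⟨(0, -1), by simp [normForm], ?_⟩
    rw [mem_hexagon, Prod.mk_sub_mk]; unfold Inside; simp only; omega
  by_cases h5 : 0 ≤ x + y ∧ y ≤ -1
  · refine ⟨(1, -1), by simp [normForm], ?_⟩
    rw [mem_hexagon, Prod.mk_sub_mk]; unfold Inside; simp only; omega
  exfalso
  omega

/-- **`H_{t+1} = H_t ∪ ⋃_{|e| = 1} (e + H_t)`** (membership form): the Minkowski sum `H_1 + H_t` is
`H_{t+1}`. [cite: DavoliPiovanoStefanelli2017, (54) p. 641] -/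
theorem mem_hexagon_succ_iff {t : ℕ} {w : ℤ × ℤ} :
    w ∈ hexagon (t + 1) ↔ w ∈ hexagon t ∨ ∃ e : ℤ × ℤ, normForm e = 1 ∧ w - e ∈ hexagon t := by
  constructor
  · intro hw
    by_cases h : w ∈ hexagon t
    · exact Or.inl h
    · exact Or.inr (exists_step_mem_hexagon hw h)
  · rintro (h | ⟨e, he, h⟩)
    · exact hexagon_mono (Nat.le_succ t) h
    · have := add_mem_hexagon_succ h he
      rwa [add_sub_cancel] at this

/-! ## §2 Erosion by hexagons and the boundary layer -/

/-- **Erosion by the unit hexagon**, `S ⊖ H₁ = {z : z + H₁ ⊆ S}`: the labels of `S` all six of whose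
lattice neighbours lie in `S` (the inner parallel set at distance one).
[cite: DavoliPiovanoStefanelli2017, (54)–(55) p. 641] -/
def erode (S : Finset (ℤ × ℤ)) : Finset (ℤ × ℤ) := S.filter fun p => ∀ q ∈ nbrs p, q ∈ S

/-- **Erosion by `H_t`**, `S ⊖ H_t = {z : z + H_t ⊆ S}`: the centres of the translates of the
hexagonal configuration `H_t` contained in `S` (the set whose non-emptiness defines the maximal
radius `r_{M_n}` in (55)). [cite: DavoliPiovanoStefanelli2017, (54)–(55) p. 641] -/
def erodeN (S : Finset (ℤ × ℤ)) (t : ℕ) : Finset (ℤ × ℤ) := S.filter fun p => ∀ u ∈ hexagon t, p + u ∈ S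

/-- **The boundary layer** `∂S = S ∖ (S ⊖ H₁)`: labels of `S` with a lattice neighbour outside `S`.
[cite: DavoliPiovanoStefanelli2017, §3 p. 641] -/
def bdLayer (S : Finset (ℤ × ℤ)) : Finset (ℤ × ℤ) := S.filter fun p => ¬ ∀ q ∈ nbrs p, q ∈ S

/-- Membership in the erosion: all neighbours present. [cite: DavoliPiovanoStefanelli2017, (54) p. 641] -/
theorem mem_erode {S : Finset (ℤ × ℤ)} {p : ℤ × ℤ} :
    p ∈ erode S ↔ p ∈ S ∧ ∀ q, Adj p q → q ∈ S := by
  unfold erode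
  rw [mem_filter]
  simp only [adj_iff_mem_nbrs]

/-- `S ⊖ H₁ ⊆ S`. [cite: DavoliPiovanoStefanelli2017, (54) p. 641] -/
theorem erode_subset (S : Finset (ℤ × ℤ)) : erode S ⊆ S := filter_subset _ _

/-- Membership in the boundary layer: some neighbour missing. [cite: DavoliPiovanoStefanelli2017, §3 p. 641] -/
theorem mem_bdLayer {S : Finset (ℤ × ℤ)} {p : ℤ × ℤ} :
    p ∈ bdLayer S ↔ p ∈ S ∧ ∃ q, Adj p q ∧ q ∉ S := by
  unfold bdLayer
  rw [mem_filter]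
  simp only [adj_iff_mem_nbrs, not_forall, exists_prop]

/-- `∂S ⊆ S`. [cite: DavoliPiovanoStefanelli2017, §3 p. 641] -/
theorem bdLayer_subset (S : Finset (ℤ × ℤ)) : bdLayer S ⊆ S := filter_subset _ _

/-- `#S = #(S ⊖ H₁) + #∂S`. [cite: DavoliPiovanoStefanelli2017, (56) p. 641] -/
theorem card_eq_card_erode_add_card_bdLayer (S : Finset (ℤ × ℤ)) :
    S.card = (erode S).card + (bdLayer S).card := by
  unfold erode bdLayer
  rw [card_filter_add_card_filter_not]

/-- Membership in `S ⊖ H_t`: the translate `p + H_t` lies in `S`. [cite: DavoliPiovanoStefanelli2017, (54) p. 641] -/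
theorem mem_erodeN {S : Finset (ℤ × ℤ)} {p : ℤ × ℤ} {t : ℕ} :
    p ∈ erodeN S t ↔ ∀ u ∈ hexagon t, p + u ∈ S := by
  unfold erodeN
  rw [mem_filter]
  exact ⟨fun h => h.2, fun h => ⟨by simpa using h 0 (zero_mem_hexagon' t), h⟩⟩

/-- `S ⊖ H_t ⊆ S`. [cite: DavoliPiovanoStefanelli2017, (54) p. 641] -/
theorem erodeN_subset (S : Finset (ℤ × ℤ)) (t : ℕ) : erodeN S t ⊆ S := filter_subset _ _

/-- `S ⊖ H_0 = S`. [cite: DavoliPiovanoStefanelli2017, (55) p. 641] -/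
theorem erodeN_zero (S : Finset (ℤ × ℤ)) : erodeN S 0 = S := by
  ext p
  rw [mem_erodeN, hexagon_zero]
  simp only [mem_singleton, forall_eq]
  rw [show ((0 : ℤ), (0 : ℤ)) = (0 : ℤ × ℤ) from rfl, add_zero]

/-- **`S ⊖ H_{t+1} = (S ⊖ H_t) ⊖ H₁`** (from `H_{t+1} = H_1 + H_t`).
[cite: DavoliPiovanoStefanelli2017, (54)–(55) p. 641] -/
theorem erodeN_succ (S : Finset (ℤ × ℤ)) (t : ℕ) : erodeN S (t + 1) = erode (erodeN S t) := by
  ext p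
  rw [mem_erodeN, mem_erode, mem_erodeN]
  constructor
  · intro h
    refine ⟨fun u hu => h u (hexagon_mono (Nat.le_succ t) hu), fun q hq => mem_erodeN.2 fun u hu => ?_⟩
    have he : normForm (q - p) = 1 := hq
    have := h ((q - p) + u) (add_mem_hexagon_succ hu he)
    convert this using 1
    abel
  · rintro ⟨h1, h2⟩ w hw
    rcases mem_hexagon_succ_iff.1 hw with h | ⟨e, he, h⟩
    · exact h1 w h
    · have hq : Adj p (p + e) := by
        show normForm (p + e - p) = 1
        rwa [add_sub_cancel_left]
      have := mem_erodeN.1 (h2 _ hq) (w - e) h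
      convert this using 1
      abel

/-- The erosions decrease. [cite: DavoliPiovanoStefanelli2017, (55) p. 641] -/
theorem erodeN_succ_subset (S : Finset (ℤ × ℤ)) (t : ℕ) : erodeN S (t + 1) ⊆ erodeN S t := by
  rw [erodeN_succ]
  exact erode_subset _

/-- … hence are antitone in the radius. [cite: DavoliPiovanoStefanelli2017, (55) p. 641] -/
theorem erodeN_antitone (S : Finset (ℤ × ℤ)) {s t : ℕ} (h : s ≤ t) : erodeN S t ⊆ erodeN S s := by
  induction h with
  | refl => exact Subset.rfl
  | step _ ih => exact (erodeN_succ_subset S _).trans ih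

/-- The erosion of a single label is empty. [folklore] -/
private theorem erode_eq_empty_of_card_eq_one {S : Finset (ℤ × ℤ)} (h : S.card = 1) : erode S = ∅ := by
  obtain ⟨p, rfl⟩ := card_eq_one.1 h
  rw [eq_empty_iff_forall_notMem]
  intro q hq
  rw [mem_erode] at hq
  obtain ⟨hq, hall⟩ := hq
  rw [mem_singleton] at hq
  subst hq
  have : (q.1 + 1, q.2) ∈ ({q} : Finset (ℤ × ℤ)) :=
    hall _ (by obtain ⟨a, b⟩ := q; simp [Adj, normForm])
  rw [mem_singleton, Prod.ext_iff] at this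
  simp at this

/-- A translate of `H_t` has more than `t` labels: if `S ⊖ H_t ≠ ∅` then `t < #S`.
[cite: DavoliPiovanoStefanelli2017, (56) p. 641] -/
theorem lt_card_of_erodeN_nonempty {S : Finset (ℤ × ℤ)} {t : ℕ} (h : (erodeN S t).Nonempty) :
    t < S.card := by
  obtain ⟨p, hp⟩ := h
  rw [mem_erodeN] at hp
  have hsub : (range (t + 1)).image (fun i : ℕ => p + ((i : ℤ), 0)) ⊆ S := by
    intro q hq
    obtain ⟨i, hi, rfl⟩ := mem_image.1 hq
    rw [mem_range] at hi
    refine hp _ ?_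
    rw [mem_hexagon]
    unfold Inside
    simp only
    omega
  have hinj : Function.Injective fun i : ℕ => p + ((i : ℤ), (0 : ℤ)) := by
    intro i j hij
    have := congrArg Prod.fst hij
    simp only [Prod.fst_add] at this
    omega
  have := card_le_card hsub
  rw [card_image_of_injective _ hinj, card_range] at this
  omega

/-- **The maximal radius exists**: for non-empty `S` there is `r` with `S ⊖ H_r ≠ ∅ = S ⊖ H_{r+1}`
(`r = r_{M_n}` of (55)). [cite: DavoliPiovanoStefanelli2017, (55) p. 641] -/
theorem exists_maxRadius {S : Finset (ℤ × ℤ)} (hS : S.Nonempty) :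
    ∃ r : ℕ, (erodeN S r).Nonempty ∧ erodeN S (r + 1) = ∅ := by
  classical
  by_contra hcon
  push Not at hcon
  have key : ∀ t, (erodeN S t).Nonempty := by
    intro t
    induction t with
    | zero => rwa [erodeN_zero]
    | succ t ih => exact hcon t ih
  have := lt_card_of_erodeN_nonempty (key S.card)
  omega

/-! ### Equivariance under the rotation `rot6` -/

/-- `rot6` is injective. [cite: HeitmannRadin1980, §2 (p. 283)] -/
theorem rot6_injective : Function.Injective rot6 := fun a b h => by
  simpa using congrArg rot6inv h

/-- `x ∈ rot6(S) ↔ rot6⁻¹ x ∈ S`. [cite: HeitmannRadin1980, §2 (p. 283)] -/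
theorem mem_image_rot6 {S : Finset (ℤ × ℤ)} {x : ℤ × ℤ} : x ∈ S.image rot6 ↔ rot6inv x ∈ S := by
  constructor
  · intro h
    obtain ⟨y, hy, rfl⟩ := mem_image.1 h
    simpa using hy
  · intro h
    exact mem_image.2 ⟨_, h, rot6_rot6inv x⟩

/-- `#rot6(S) = #S`. [cite: HeitmannRadin1980, §2 (p. 283)] -/
theorem card_image_rot6 (S : Finset (ℤ × ℤ)) : (S.image rot6).card = S.card :=
  card_image_of_injective _ rot6_injective

/-- Adjacency is transported by `rot6⁻¹`. [cite: HeitmannRadin1980, §2 (p. 283)] -/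
theorem adj_rot6inv_iff (p q : ℤ × ℤ) : Adj (rot6inv p) (rot6inv q) ↔ Adj p q := by
  rw [← adj_rot6_iff, rot6_rot6inv, rot6_rot6inv]

/-- **Erosion commutes with the rotation**: `rot6(S) ⊖ H₁ = rot6(S ⊖ H₁)`.
[cite: HeitmannRadin1980, §2 (p. 283)] -/
theorem erode_image_rot6 (S : Finset (ℤ × ℤ)) : erode (S.image rot6) = (erode S).image rot6 := by
  ext x
  rw [mem_erode, mem_image_rot6, mem_image_rot6, mem_erode]
  constructor
  · rintro ⟨h1, h2⟩
    refine ⟨h1, fun q hq => ?_⟩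
    have h3 : Adj x (rot6 q) := by
      rw [← rot6_rot6inv x, adj_rot6_iff]
      exact hq
    simpa using mem_image_rot6.1 (h2 _ h3)
  · rintro ⟨h1, h2⟩
    exact ⟨h1, fun q hq => mem_image_rot6.2 (h2 _ ((adj_rot6inv_iff x q).2 hq))⟩

/-- `rot6(S) ⊖ H_t = rot6(S ⊖ H_t)`. [cite: HeitmannRadin1980, §2 (p. 283)] -/
theorem erodeN_image_rot6 (S : Finset (ℤ × ℤ)) (t : ℕ) :
    erodeN (S.image rot6) t = (erodeN S t).image rot6 := by
  induction t with
  | zero => rw [erodeN_zero, erodeN_zero]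
  | succ t ih => rw [erodeN_succ, erodeN_succ, ih, erode_image_rot6]

/-! ## §3 The number of occupied lattice lines -/

/-- **The number of lattice lines meeting `S`** in the three directions of `A₂`: occupied rows
`{n : (m,n) ∈ S}`, occupied diagonals `{m + n}` (the rows of `rot6 S`) and occupied columns `{m}`
(the rows of `rot6² S`). For a 3-convex `S` this is `3 #S − b(S)` (`bondCount_add_lineCount`), i.e.
half the edge perimeter `|Θ(S)| = 6n − 2b`. [cite: DavoliPiovanoStefanelli2017, (10) p. 630 and (59) p. 643] -/
def lineCount (S : Finset (ℤ × ℤ)) : ℕ :=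
  (S.image Prod.snd).card + ((S.image rot6).image Prod.snd).card +
    (((S.image rot6).image rot6).image Prod.snd).card

/-- The rotation re-indexes the three line counts cyclically: the second coordinate of `rot6² q`
is the first coordinate of `q`. [cite: HeitmannRadin1980, §2 (p. 283)] -/
theorem snd_rot6_rot6 (q : ℤ × ℤ) : (rot6 (rot6 q)).2 = q.1 := by
  obtain ⟨a, b⟩ := q
  simp [rot6]

/-- The occupied rows of `rot6 S` are the occupied diagonals `{m + n}` of `S`.
[cite: HeitmannRadin1980, §2 (p. 283)] -/
theorem image_snd_image_rot6 (S : Finset (ℤ × ℤ)) :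
    (S.image rot6).image Prod.snd = S.image fun q => q.1 + q.2 := by
  rw [image_image]
  rfl

/-- The occupied rows of `rot6² S` are the occupied columns `{m}` of `S`.
[cite: HeitmannRadin1980, §2 (p. 283)] -/
theorem image_snd_image_rot6_rot6 (S : Finset (ℤ × ℤ)) :
    ((S.image rot6).image rot6).image Prod.snd = S.image Prod.fst := by
  rw [image_image, image_image]
  exact image_congr fun q _ => snd_rot6_rot6 q

/-- **Erosion loses the two extreme rows**: if `S ⊖ H₁ ≠ ∅` then `#rows(S ⊖ H₁) + 2 ≤ #rows(S)`
(a label of the eroded set in its top row has its upper neighbour in `S`, one row higher; likewise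
at the bottom). [cite: DavoliPiovanoStefanelli2017, (59)–(62) p. 643–645] -/
theorem card_rows_erode_add_two_le {S : Finset (ℤ × ℤ)} (h : (erode S).Nonempty) :
    ((erode S).image Prod.snd).card + 2 ≤ (S.image Prod.snd).card := by
  set V' := (erode S).image Prod.snd with hV'def
  have hV' : V'.Nonempty := h.image _
  obtain ⟨zM, hzM, hzM2⟩ : ∃ z ∈ erode S, z.2 = V'.max' hV' := by
    simpa [hV'def] using V'.max'_mem hV'
  obtain ⟨zm, hzm, hzm2⟩ : ∃ z ∈ erode S, z.2 = V'.min' hV' := by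
    simpa [hV'def] using V'.min'_mem hV'
  have hup : (zM.1, zM.2 + 1) ∈ S :=
    (mem_erode.1 hzM).2 _ (by obtain ⟨a, b⟩ := zM; simp [Adj, normForm])
  have hdn : (zm.1, zm.2 - 1) ∈ S :=
    (mem_erode.1 hzm).2 _ (by obtain ⟨a, b⟩ := zm; simp [Adj, normForm])
  have hmM : V'.min' hV' ≤ V'.max' hV' := min'_le V' _ (max'_mem V' hV')
  have h1 : V'.min' hV' - 1 ∉ V' := fun hh => by
    have := V'.min'_le _ hh
    omega
  have h2 : V'.max' hV' + 1 ∉ insert (V'.min' hV' - 1) V' := by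
    rw [mem_insert, not_or]
    refine ⟨by omega, fun hh => ?_⟩
    have := V'.le_max' _ hh
    omega
  have hsub : insert (V'.max' hV' + 1) (insert (V'.min' hV' - 1) V') ⊆ S.image Prod.snd := by
    intro v hv
    rcases mem_insert.1 hv with rfl | hv
    · exact mem_image.2 ⟨_, hup, by simp [hzM2]⟩
    rcases mem_insert.1 hv with rfl | hv
    · exact mem_image.2 ⟨_, hdn, by simp [hzm2]⟩
    · obtain ⟨z, hz, rfl⟩ := mem_image.1 hv
      exact mem_image.2 ⟨z, erode_subset S hz, rfl⟩
  calc V'.card + 2 = (insert (V'.max' hV' + 1) (insert (V'.min' hV' - 1) V')).card := by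
        rw [card_insert_of_notMem h2, card_insert_of_notMem h1]
    _ ≤ (S.image Prod.snd).card := card_le_card hsub

/-- **`L(S ⊖ H₁) + 6 ≤ L(S)`** when `S ⊖ H₁ ≠ ∅`: two lines lost in each of the three directions.
[cite: DavoliPiovanoStefanelli2017, (62) p. 645] -/
theorem lineCount_erode_add_six_le {S : Finset (ℤ × ℤ)} (h : (erode S).Nonempty) :
    lineCount (erode S) + 6 ≤ lineCount S := by
  have h1 := card_rows_erode_add_two_le h
  have h' : (erode (S.image rot6)).Nonempty := by
    rw [erode_image_rot6]; exact h.image _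
  have h2 := card_rows_erode_add_two_le h'
  have h'' : (erode ((S.image rot6).image rot6)).Nonempty := by
    rw [erode_image_rot6, erode_image_rot6]; exact (h.image _).image _
  have h3 := card_rows_erode_add_two_le h''
  rw [erode_image_rot6] at h2
  rw [erode_image_rot6, erode_image_rot6] at h3
  unfold lineCount
  omega

/-- **`L(S ⊖ H_t) + 6t ≤ L(S)`** as long as `S ⊖ H_t ≠ ∅`. [cite: DavoliPiovanoStefanelli2017, (62) p. 645] -/
theorem lineCount_erodeN_add_le {S : Finset (ℤ × ℤ)} {t : ℕ} (h : (erodeN S t).Nonempty) :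
    lineCount (erodeN S t) + 6 * t ≤ lineCount S := by
  induction t with
  | zero => rw [erodeN_zero]; omega
  | succ t ih =>
    have ht : (erodeN S t).Nonempty := h.mono (erodeN_succ_subset S t)
    have h' : (erode (erodeN S t)).Nonempty := by rwa [← erodeN_succ]
    have := lineCount_erode_add_six_le h'
    rw [← erodeN_succ] at this
    have := ih ht
    omega

/-! ## §4 Three-convexity; bonds versus lines -/

/-- **`S` is 3-convex** ([DavoliPiovanoStefanelli2017, Definition 3.2]): every lattice line of `A₂`,
in each of the three directions `t₁, t₂, t₃ = t₂ − t₁`, meets `S` in an interval — row-convexity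
of `S`, of `rot6 S` and of `rot6² S`. [cite: DavoliPiovanoStefanelli2017, Definition 3.2 p. 643] -/
def IsTriConvex (S : Finset (ℤ × ℤ)) : Prop :=
  IsRowConvex S ∧ IsRowConvex (S.image rot6) ∧ IsRowConvex ((S.image rot6).image rot6)

/-- **Erosion preserves row-convexity.** [cite: DavoliPiovanoStefanelli2017, Proposition 3.3 p. 644] -/
theorem isRowConvex_erode {S : Finset (ℤ × ℤ)} (h : IsRowConvex S) : IsRowConvex (erode S) := by
  intro t a m c ha hc ham hmc
  rw [mem_erode] at ha hc ⊢
  refine ⟨h t a m c ha.1 hc.1 ham hmc, fun q hq => ?_⟩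
  set e := q - (m, t) with he_def
  have he : normForm e = 1 := hq
  have hq' : q = (m + e.1, t + e.2) := by
    ext <;> simp [he_def]
  have hadj : ∀ x : ℤ, Adj (x, t) (x + e.1, t + e.2) := by
    intro x
    show normForm ((x + e.1, t + e.2) - (x, t)) = 1
    have : ((x + e.1, t + e.2) : ℤ × ℤ) - (x, t) = e := by ext <;> simp
    rw [this]
    exact he
  rw [hq']
  exact h (t + e.2) (a + e.1) (m + e.1) (c + e.1) (ha.2 _ (hadj a)) (hc.2 _ (hadj c))
    (by omega) (by omega)

/-- **Erosion preserves 3-convexity.** [cite: DavoliPiovanoStefanelli2017, Proposition 3.3 p. 644] -/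
theorem isTriConvex_erode {S : Finset (ℤ × ℤ)} (h : IsTriConvex S) : IsTriConvex (erode S) := by
  refine ⟨isRowConvex_erode h.1, ?_, ?_⟩
  · rw [← erode_image_rot6]; exact isRowConvex_erode h.2.1
  · rw [← erode_image_rot6, ← erode_image_rot6]; exact isRowConvex_erode h.2.2

/-- … and so do the erosions by `H_t`. [cite: DavoliPiovanoStefanelli2017, Proposition 3.3 p. 644] -/
theorem isTriConvex_erodeN {S : Finset (ℤ × ℤ)} (h : IsTriConvex S) (t : ℕ) : IsTriConvex (erodeN S t) := by
  induction t with
  | zero => rwa [erodeN_zero]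
  | succ t ih => rw [erodeN_succ]; exact isTriConvex_erode ih

/-! ### Coordinates of translated labels (plumbing) -/

/-- `(m+1, n) = q + (1,0)`. [folklore] -/
private theorem v10 (q : ℤ × ℤ) : (q.1 + 1, q.2) = q + (1, 0) := by
  obtain ⟨x, y⟩ := q
  show ((x + 1, y) : ℤ × ℤ) = (x + 1, y + 0)
  rw [Prod.mk.injEq]; exact ⟨by omega, by omega⟩

/-- `(m, n+1) = q + (0,1)`. [folklore] -/
private theorem v01 (q : ℤ × ℤ) : (q.1, q.2 + 1) = q + (0, 1) := by
  obtain ⟨x, y⟩ := q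
  show ((x, y + 1) : ℤ × ℤ) = (x + 0, y + 1)
  rw [Prod.mk.injEq]; exact ⟨by omega, by omega⟩

/-- `(m−1, n+1) = q + (−1,1)`. [folklore] -/
private theorem vm11 (q : ℤ × ℤ) : (q.1 - 1, q.2 + 1) = q + (-1, 1) := by
  obtain ⟨x, y⟩ := q
  show ((x - 1, y + 1) : ℤ × ℤ) = (x + -1, y + 1)
  rw [Prod.mk.injEq]; exact ⟨by omega, by omega⟩

/-- `(m−1, n) = q + (−1,0)`. [folklore] -/
private theorem vm10 (q : ℤ × ℤ) : (q.1 - 1, q.2) = q + (-1, 0) := by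
  obtain ⟨x, y⟩ := q
  show ((x - 1, y) : ℤ × ℤ) = (x + -1, y + 0)
  rw [Prod.mk.injEq]; exact ⟨by omega, by omega⟩

/-- `(m, n−1) = q + (0,−1)`. [folklore] -/
private theorem v0m1 (q : ℤ × ℤ) : (q.1, q.2 - 1) = q + (0, -1) := by
  obtain ⟨x, y⟩ := q
  show ((x, y - 1) : ℤ × ℤ) = (x + 0, y + -1)
  rw [Prod.mk.injEq]; exact ⟨by omega, by omega⟩

/-- `(m+1, n−1) = q + (1,−1)`. [folklore] -/
private theorem v1m1 (q : ℤ × ℤ) : (q.1 + 1, q.2 - 1) = q + (1, -1) := by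
  obtain ⟨x, y⟩ := q
  show ((x + 1, y - 1) : ℤ × ℤ) = (x + 1, y + -1)
  rw [Prod.mk.injEq]; exact ⟨by omega, by omega⟩

/-- `q + (1,−1) = q − (−1,1)`. [folklore] -/
private theorem w1 (q : ℤ × ℤ) : q + ((1 : ℤ), (-1 : ℤ)) = q - ((-1 : ℤ), (1 : ℤ)) := by
  obtain ⟨x, y⟩ := q
  show ((x + 1, y + -1) : ℤ × ℤ) = (x - -1, y - 1)
  rw [Prod.mk.injEq]; exact ⟨by omega, by omega⟩

/-- `q − (−1,0) = q + (1,0)`. [folklore] -/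
private theorem w2 (q : ℤ × ℤ) : q - ((-1 : ℤ), (0 : ℤ)) = q + (1, 0) := by
  obtain ⟨x, y⟩ := q
  show ((x - -1, y - 0) : ℤ × ℤ) = (x + 1, y + 0)
  rw [Prod.mk.injEq]; exact ⟨by omega, by omega⟩

/-- `q + (1,0) + (−1,1) = q + (0,1)`. [folklore] -/
private theorem w3 (q : ℤ × ℤ) : q + ((1 : ℤ), (0 : ℤ)) + ((-1 : ℤ), (1 : ℤ)) = q + (0, 1) := by
  obtain ⟨x, y⟩ := q
  show ((x + 1 + -1, y + 0 + 1) : ℤ × ℤ) = (x + 0, y + 1)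
  rw [Prod.mk.injEq]; exact ⟨by omega, by omega⟩

/-- `q − (0,−1) = q + (0,1)`. [folklore] -/
private theorem w4 (q : ℤ × ℤ) : q - ((0 : ℤ), (-1 : ℤ)) = q + (0, 1) := by
  obtain ⟨x, y⟩ := q
  show ((x - 0, y - -1) : ℤ × ℤ) = (x + 0, y + 1)
  rw [Prod.mk.injEq]; exact ⟨by omega, by omega⟩

/-- `q + (0,1) + (−1,0) = q + (−1,1)`. [folklore] -/
private theorem w5 (q : ℤ × ℤ) : q + ((0 : ℤ), (1 : ℤ)) + ((-1 : ℤ), (0 : ℤ)) = q + (-1, 1) := by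
  obtain ⟨x, y⟩ := q
  show ((x + 0 + -1, y + 1 + 0) : ℤ × ℤ) = (x + -1, y + 1)
  rw [Prod.mk.injEq]; exact ⟨by omega, by omega⟩

/-- `q + (0,1) + (1,−1) = q + (1,0)`. [folklore] -/
private theorem w6 (q : ℤ × ℤ) : q + ((0 : ℤ), (1 : ℤ)) + ((1 : ℤ), (-1 : ℤ)) = q + (1, 0) := by
  obtain ⟨x, y⟩ := q
  show ((x + 0 + 1, y + 1 + -1) : ℤ × ℤ) = (x + 1, y + 0)
  rw [Prod.mk.injEq]; exact ⟨by omega, by omega⟩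

/-- `q − (1,−1) = q + (−1,1)`. [folklore] -/
private theorem w7 (q : ℤ × ℤ) : q - ((1 : ℤ), (-1 : ℤ)) = q + (-1, 1) := by
  obtain ⟨x, y⟩ := q
  show ((x - 1, y - -1) : ℤ × ℤ) = (x + -1, y + 1)
  rw [Prod.mk.injEq]; exact ⟨by omega, by omega⟩

/-- `q + (−1,1) + (1,0) = q + (0,1)`. [folklore] -/
private theorem w8 (q : ℤ × ℤ) : q + ((-1 : ℤ), (1 : ℤ)) + ((1 : ℤ), (0 : ℤ)) = q + (0, 1) := by
  obtain ⟨x, y⟩ := q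
  show ((x + -1 + 1, y + 1 + 0) : ℤ × ℤ) = (x + 0, y + 1)
  rw [Prod.mk.injEq]; exact ⟨by omega, by omega⟩

/-- Counting a two-point pattern from either end. [folklore] -/
private theorem card_filter_shift_pair (S : Finset (ℤ × ℤ)) (u : ℤ × ℤ) :
    (S.filter fun q => q - u ∈ S).card = (S.filter fun q => q + u ∈ S).card := by
  have h : (S.filter fun q => q - u ∈ S) = (S.filter fun q => q + u ∈ S).image (· + u) := by
    ext q
    simp only [mem_filter, mem_image]
    constructor
    · rintro ⟨h1, h2⟩
      exact ⟨q - u, ⟨h2, by simpa using h1⟩, by simp⟩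
    · rintro ⟨q', ⟨h1, h2⟩, rfl⟩
      exact ⟨h2, by simpa using h1⟩
  rw [h, card_image_of_injective _ (add_left_injective u)]

/-- A pattern `{q, q + v} ⊆ rot6 S` counted in `rot6 S` is the pattern `{q, q + rot6⁻¹ v}` counted in `S`.
[cite: HeitmannRadin1980, §2 (p. 283)] -/
private theorem card_filter_image_rot6 (S : Finset (ℤ × ℤ)) (v : ℤ × ℤ) :
    ((S.image rot6).filter fun p => p + v ∈ S.image rot6).card =
      (S.filter fun q => q + rot6inv v ∈ S).card := by
  have h : ((S.image rot6).filter fun p => p + v ∈ S.image rot6) =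
      (S.filter fun q => q + rot6inv v ∈ S).image rot6 := by
    ext p
    constructor
    · intro hp
      rw [mem_filter, mem_image_rot6, mem_image_rot6] at hp
      obtain ⟨h1, h2⟩ := hp
      refine mem_image.2 ⟨rot6inv p, mem_filter.2 ⟨h1, ?_⟩, rot6_rot6inv p⟩
      have : rot6inv (p + v) = rot6inv p + rot6inv v := by
        obtain ⟨a, b⟩ := p; obtain ⟨c, d⟩ := v
        simp only [rot6inv, Prod.mk_add_mk, Prod.mk.injEq]; constructor <;> ring
      rwa [this] at h2
    · intro hp
      obtain ⟨q, hq, rfl⟩ := mem_image.1 hp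
      rw [mem_filter] at hq
      rw [mem_filter, mem_image_rot6, mem_image_rot6, rot6inv_rot6]
      refine ⟨hq.1, ?_⟩
      have : rot6inv (rot6 q + v) = q + rot6inv v := by
        obtain ⟨a, b⟩ := q; obtain ⟨c, d⟩ := v
        simp only [rot6, rot6inv, Prod.mk_add_mk, Prod.mk.injEq]; constructor <;> ring
      rw [this]
      exact hq.2
  rw [h, card_image_of_injective _ rot6_injective]

/-- **The horizontal bonds of `rot6 S` are the `t₃`-bonds of `S`.** [cite: HararyHarborth1976, hexagonal animals] -/
theorem horizBonds_image_rot6 (S : Finset (ℤ × ℤ)) : horizBonds (S.image rot6) = diagBonds S := by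
  unfold horizBonds diagBonds
  have e1 : ((S.image rot6).filter fun q => (q.1 + 1, q.2) ∈ S.image rot6) =
      ((S.image rot6).filter fun p => p + (1, 0) ∈ S.image rot6) := by
    refine filter_congr fun q _ => ?_
    rw [v10]
  rw [e1, card_filter_image_rot6]
  have e2 : rot6inv (1, 0) = (1, -1) := by simp [rot6inv]
  rw [e2]
  have e3 : (S.filter fun q => q + ((1 : ℤ), (-1 : ℤ)) ∈ S) = S.filter fun q => q - ((-1 : ℤ), (1 : ℤ)) ∈ S := by
    refine filter_congr fun q _ => ?_
    rw [w1]
  rw [e3, card_filter_shift_pair]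
  refine congrArg _ (filter_congr fun q _ => ?_)
  rw [vm11]

/-- **The `t₃`-bonds of `rot6 S` are the vertical bonds of `S`.** [cite: HararyHarborth1976, hexagonal animals] -/
theorem diagBonds_image_rot6 (S : Finset (ℤ × ℤ)) : diagBonds (S.image rot6) = vertBonds S := by
  unfold diagBonds vertBonds
  have e1 : ((S.image rot6).filter fun q => (q.1 - 1, q.2 + 1) ∈ S.image rot6) =
      ((S.image rot6).filter fun p => p + (-1, 1) ∈ S.image rot6) := by
    refine filter_congr fun q _ => ?_
    rw [vm11]
  rw [e1, card_filter_image_rot6]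
  have e2 : rot6inv (-1, 1) = (0, 1) := by simp [rot6inv]
  rw [e2]
  refine congrArg _ (filter_congr fun q _ => ?_)
  rw [v01]

/-- **`b + L = 3n` for 3-convex `S`**: an interval of `k` labels on a line carries `k − 1` bonds, in
each of the three directions (`|Θ(S)| = 6n − 2b = 2L`). [cite: DavoliPiovanoStefanelli2017, (10) p. 630] -/
theorem bondCount_add_lineCount {S : Finset (ℤ × ℤ)} (h : IsTriConvex S) :
    bondCount S + lineCount S = 3 * S.card := by
  have h1 := horizBonds_add_card_rows_eq h.1
  have h2 := horizBonds_add_card_rows_eq h.2.1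
  have h3 := horizBonds_add_card_rows_eq h.2.2
  rw [horizBonds_image_rot6, card_image_rot6] at h2
  rw [horizBonds_image_rot6, diagBonds_image_rot6, card_image_rot6, card_image_rot6] at h3
  unfold bondCount lineCount
  omega

/-! ## §5 Charging: the boundary layer against the line count -/

/-- The indicator is at most one. [folklore] -/
private theorem ind_le_one (S : Finset (ℤ × ℤ)) (q : ℤ × ℤ) : ind S q ≤ 1 := by
  unfold ind; split_ifs <;> omega

/-- The indicator as `Bool.toNat`. [folklore] -/
private theorem ind_eq_toNat (S : Finset (ℤ × ℤ)) (q : ℤ × ℤ) : ind S q = (decide (q ∈ S)).toNat := by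
  unfold ind
  by_cases h : q ∈ S <;> simp [h]

/-- **The number of unit triangles of `S` with a corner at `p`** (the "wedges" around `p`: pairs of
cyclically consecutive neighbours `p + ζ^i, p + ζ^{i+1}` both in `S`), as a sum of six products of
indicators. [cite: DavoliPiovanoStefanelli2017, (25) p. 635] -/
def wedges (S : Finset (ℤ × ℤ)) (p : ℤ × ℤ) : ℕ :=
  ind S (p.1 + 1, p.2) * ind S (p.1, p.2 + 1) + ind S (p.1, p.2 + 1) * ind S (p.1 - 1, p.2 + 1) +
    ind S (p.1 - 1, p.2 + 1) * ind S (p.1 - 1, p.2) + ind S (p.1 - 1, p.2) * ind S (p.1, p.2 - 1) +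
    ind S (p.1, p.2 - 1) * ind S (p.1 + 1, p.2 - 1) + ind S (p.1 + 1, p.2 - 1) * ind S (p.1 + 1, p.2)

/-- The local fact behind the charging: for a proper non-empty subset `N` of the cyclic group `ℤ/6`
(the directions of the neighbours of a boundary label), the number of cyclically consecutive pairs
in `N` is at most `|N| − 1`; written for six Booleans. [folklore] -/
private theorem key6 : ∀ a b c d e f : Bool,
    a.toNat * c.toNat + c.toNat * f.toNat + f.toNat * b.toNat + b.toNat * d.toNat +
        d.toNat * e.toNat + e.toNat * a.toNat +
      (if 0 < a.toNat + b.toNat + c.toNat + d.toNat + e.toNat + f.toNat ∧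
          a.toNat + b.toNat + c.toNat + d.toNat + e.toNat + f.toNat < 6 then 1 else 0) ≤
    a.toNat + b.toNat + c.toNat + d.toNat + e.toNat + f.toNat +
      (if a.toNat + b.toNat + c.toNat + d.toNat + e.toNat + f.toNat = 0 then 1 else 0) := by
  decide

/-- **Charging at one label**: `w(p) + [0 < d(p) < 6] ≤ d(p) + [d(p) = 0]`, with `d(p)` the number
of neighbours of `p` in `S` and `w(p)` the number of wedges. [cite: DavoliPiovanoStefanelli2017, (38)–(41) p. 638–639] -/
theorem wedges_add_le (S : Finset (ℤ × ℤ)) (p : ℤ × ℤ) :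
    wedges S p + (if 0 < (S.filter (Adj p)).card ∧ (S.filter (Adj p)).card < 6 then 1 else 0) ≤
      (S.filter (Adj p)).card + (if (S.filter (Adj p)).card = 0 then 1 else 0) := by
  rw [card_filter_adj]
  unfold wedges
  simp only [ind_eq_toNat]
  exact key6 _ _ _ _ _ _

/-- Sum of a product of two indicators: a two-point pattern count. [folklore] -/
private theorem sum_ind_mul_ind (S : Finset (ℤ × ℤ)) (u v : ℤ × ℤ) :
    ∑ p ∈ S, ind S (p + u) * ind S (p + v) = (S.filter fun p => p + u ∈ S ∧ p + v ∈ S).card := by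
  rw [card_filter]
  refine sum_congr rfl fun p _ => ?_
  unfold ind
  split_ifs <;> simp_all

/-- Re-anchoring a three-point pattern by a translation. [folklore] -/
private theorem card_filter_pair_shift (S : Finset (ℤ × ℤ)) (u v : ℤ × ℤ) :
    (S.filter fun p => p + u ∈ S ∧ p + v ∈ S).card =
      (S.filter fun q => q - u ∈ S ∧ q - u + v ∈ S).card := by
  have h : (S.filter fun q => q - u ∈ S ∧ q - u + v ∈ S) =
      (S.filter fun p => p + u ∈ S ∧ p + v ∈ S).image (· + u) := by
    ext q
    simp only [mem_filter, mem_image]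
    constructor
    · rintro ⟨h1, h2, h3⟩
      exact ⟨q - u, ⟨h2, by simpa using h1, h3⟩, by simp⟩
    · rintro ⟨q', ⟨h1, h2, h3⟩, rfl⟩
      exact ⟨h2, by simpa using h1, by simpa using h3⟩
  rw [h, card_image_of_injective _ (add_left_injective u)]

/-- **`Σ_{p ∈ S} w(p) = 3 A(S)`**: each unit triangle has three corners (the six wedge types are the
up / down triangles anchored at `p`, `p − (1,0)`, `p − (0,1)`, `p − (1,−1)`).
[cite: DavoliPiovanoStefanelli2017, (25) p. 635] -/
theorem sum_wedges_eq (S : Finset (ℤ × ℤ)) : ∑ p ∈ S, wedges S p = 3 * triCount S := by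
  have hU : (upTri S).card = (S.filter fun p => p + (1, 0) ∈ S ∧ p + (0, 1) ∈ S).card := by
    unfold upTri
    refine congrArg _ (filter_congr fun q _ => ?_)
    rw [v10, v01]
  have hD : (downTri S).card = (S.filter fun p => p + (-1, 1) ∈ S ∧ p + (0, 1) ∈ S).card := by
    unfold downTri
    refine congrArg _ (filter_congr fun q _ => ?_)
    rw [vm11, v01]
  -- the six wedge types
  have w0 : ∑ p ∈ S, ind S (p.1 + 1, p.2) * ind S (p.1, p.2 + 1) = (upTri S).card := by
    rw [hU, ← sum_ind_mul_ind]
    refine sum_congr rfl fun p _ => ?_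
    rw [v10, v01]
  have w1 : ∑ p ∈ S, ind S (p.1, p.2 + 1) * ind S (p.1 - 1, p.2 + 1) = (downTri S).card := by
    rw [hD, ← sum_ind_mul_ind]
    refine sum_congr rfl fun p _ => ?_
    rw [vm11, v01, mul_comm]
  have w2 : ∑ p ∈ S, ind S (p.1 - 1, p.2 + 1) * ind S (p.1 - 1, p.2) = (upTri S).card := by
    have : ∑ p ∈ S, ind S (p.1 - 1, p.2 + 1) * ind S (p.1 - 1, p.2) =
        ∑ p ∈ S, ind S (p + (-1, 0)) * ind S (p + (-1, 1)) := by
      refine sum_congr rfl fun p _ => ?_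
      rw [vm11, vm10, mul_comm]
    rw [this, sum_ind_mul_ind, card_filter_pair_shift, hU]
    refine congrArg _ (filter_congr fun q _ => ?_)
    rw [w2, w3]
  have w3 : ∑ p ∈ S, ind S (p.1 - 1, p.2) * ind S (p.1, p.2 - 1) = (downTri S).card := by
    have : ∑ p ∈ S, ind S (p.1 - 1, p.2) * ind S (p.1, p.2 - 1) =
        ∑ p ∈ S, ind S (p + (0, -1)) * ind S (p + (-1, 0)) := by
      refine sum_congr rfl fun p _ => ?_
      rw [vm10, v0m1, mul_comm]
    rw [this, sum_ind_mul_ind, card_filter_pair_shift, hD]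
    refine congrArg _ (filter_congr fun q _ => ?_)
    rw [w4, w5]
    rw [and_comm]
  have w4 : ∑ p ∈ S, ind S (p.1, p.2 - 1) * ind S (p.1 + 1, p.2 - 1) = (upTri S).card := by
    have : ∑ p ∈ S, ind S (p.1, p.2 - 1) * ind S (p.1 + 1, p.2 - 1) =
        ∑ p ∈ S, ind S (p + (0, -1)) * ind S (p + (1, -1)) := by
      refine sum_congr rfl fun p _ => ?_
      rw [v0m1, v1m1]
    rw [this, sum_ind_mul_ind, card_filter_pair_shift, hU]
    refine congrArg _ (filter_congr fun q _ => ?_)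
    rw [w4, w6]
    rw [and_comm]
  have w5 : ∑ p ∈ S, ind S (p.1 + 1, p.2 - 1) * ind S (p.1 + 1, p.2) = (downTri S).card := by
    have : ∑ p ∈ S, ind S (p.1 + 1, p.2 - 1) * ind S (p.1 + 1, p.2) =
        ∑ p ∈ S, ind S (p + (1, -1)) * ind S (p + (1, 0)) := by
      refine sum_congr rfl fun p _ => ?_
      rw [v1m1, v10]
    rw [this, sum_ind_mul_ind, card_filter_pair_shift, hD]
    refine congrArg _ (filter_congr fun q _ => ?_)
    rw [w7, w8]
  unfold wedges triCount
  simp only [sum_add_distrib]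
  rw [w0, w1, w2, w3, w4, w5]
  ring

/-- **Charging, summed**: `3A + #{0 < d < 6} ≤ 2b + #{d = 0}`.
[cite: DavoliPiovanoStefanelli2017, (34)–(37) p. 638] -/
theorem three_mul_triCount_add_card_le (S : Finset (ℤ × ℤ)) :
    3 * triCount S + (S.filter fun p => 0 < (S.filter (Adj p)).card ∧ (S.filter (Adj p)).card < 6).card ≤
      adjCount S + (S.filter fun p => (S.filter (Adj p)).card = 0).card := by
  rw [← sum_wedges_eq, card_filter, card_filter, adjCount, ← sum_add_distrib, ← sum_add_distrib]
  exact sum_le_sum fun p _ => wedges_add_le S p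

/-- `d(p) ≤ 6`. [cite: DavoliPiovanoStefanelli2017, (10) p. 630] -/
theorem card_filter_adj_le_six (S : Finset (ℤ × ℤ)) (p : ℤ × ℤ) : (S.filter (Adj p)).card ≤ 6 := by
  rw [card_filter_adj]
  have := ind_le_one S (p.1 + 1, p.2); have := ind_le_one S (p.1 - 1, p.2)
  have := ind_le_one S (p.1, p.2 + 1); have := ind_le_one S (p.1, p.2 - 1)
  have := ind_le_one S (p.1 + 1, p.2 - 1); have := ind_le_one S (p.1 - 1, p.2 + 1)
  omega

/-- `ind S q = 1 ↔ q ∈ S`. [folklore] -/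
private theorem ind_eq_one_iff {S : Finset (ℤ × ℤ)} {q : ℤ × ℤ} : ind S q = 1 ↔ q ∈ S := by
  unfold ind; split_ifs with h <;> simp [h]

/-- `ind S q = 0 ↔ q ∉ S`. [folklore] -/
private theorem ind_eq_zero_iff {S : Finset (ℤ × ℤ)} {q : ℤ × ℤ} : ind S q = 0 ↔ q ∉ S := by
  unfold ind; split_ifs with h <;> simp [h]

/-- All six neighbours present iff `d(p) = 6`. [cite: DavoliPiovanoStefanelli2017, (10) p. 630] -/
theorem forall_nbrs_mem_iff {S : Finset (ℤ × ℤ)} {p : ℤ × ℤ} :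
    (∀ q ∈ nbrs p, q ∈ S) ↔ (S.filter (Adj p)).card = 6 := by
  rw [card_filter_adj]
  have l1 := ind_le_one S (p.1 + 1, p.2); have l2 := ind_le_one S (p.1 - 1, p.2)
  have l3 := ind_le_one S (p.1, p.2 + 1); have l4 := ind_le_one S (p.1, p.2 - 1)
  have l5 := ind_le_one S (p.1 + 1, p.2 - 1); have l6 := ind_le_one S (p.1 - 1, p.2 + 1)
  simp only [nbrs, forall_mem_insert, mem_singleton, forall_eq]
  rw [← ind_eq_one_iff (S := S), ← ind_eq_one_iff (S := S), ← ind_eq_one_iff (S := S),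
    ← ind_eq_one_iff (S := S), ← ind_eq_one_iff (S := S), ← ind_eq_one_iff (S := S)]
  omega

/-- The boundary layer is `{d < 6}`. [cite: DavoliPiovanoStefanelli2017, §3 p. 641] -/
theorem mem_bdLayer_iff_card {S : Finset (ℤ × ℤ)} {p : ℤ × ℤ} :
    p ∈ bdLayer S ↔ p ∈ S ∧ (S.filter (Adj p)).card < 6 := by
  unfold bdLayer
  rw [mem_filter, forall_nbrs_mem_iff]
  have := card_filter_adj_le_six S p
  constructor
  · rintro ⟨h1, h2⟩; exact ⟨h1, by omega⟩
  · rintro ⟨h1, h2⟩; exact ⟨h1, by omega⟩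

/-- An isolated label of a row-convex `S` is alone in its row. [cite: HararyHarborth1976, hexagonal animals] -/
theorem row_eq_singleton_of_isolated {S : Finset (ℤ × ℤ)} (hconv : IsRowConvex S) {p : ℤ × ℤ}
    (hp : p ∈ S) (h0 : (S.filter (Adj p)).card = 0) : row S p.2 = {p.1} := by
  rw [card_filter_adj] at h0
  have hr : (p.1 + 1, p.2) ∉ S := ind_eq_zero_iff.1 (by omega)
  have hl : (p.1 - 1, p.2) ∉ S := ind_eq_zero_iff.1 (by omega)
  ext m
  rw [mem_row, mem_singleton]
  constructor
  · intro hm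
    by_contra hne
    rcases lt_or_gt_of_ne hne with hlt | hgt
    · exact hl (hconv p.2 m (p.1 - 1) p.1 hm (by obtain ⟨a, b⟩ := p; exact hp) (by omega) (by omega))
    · exact hr (hconv p.2 p.1 (p.1 + 1) m (by obtain ⟨a, b⟩ := p; exact hp) hm (by omega) (by omega))
  · rintro rfl
    obtain ⟨a, b⟩ := p; exact hp

/-- An isolated label's row carries no bond upwards. [cite: HararyHarborth1976, hexagonal animals] -/
theorem rowBonds_eq_zero_of_isolated {S : Finset (ℤ × ℤ)} (hconv : IsRowConvex S) {p : ℤ × ℤ}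
    (hp : p ∈ S) (h0 : (S.filter (Adj p)).card = 0) : rowBonds S p.2 = 0 := by
  have hrow := row_eq_singleton_of_isolated hconv hp h0
  rw [card_filter_adj] at h0
  have hu : (p.1, p.2 + 1) ∉ S := ind_eq_zero_iff.1 (by omega)
  have hd : (p.1 - 1, p.2 + 1) ∉ S := ind_eq_zero_iff.1 (by omega)
  unfold rowBonds
  rw [hrow]
  simp only [filter_singleton, mem_row]
  rw [if_neg hu, if_neg hd]
  rfl

/-- **The layer bound** for non-empty 3-convex `S`: `#∂S + 3 ≤ L(S) + [#S = 1]`.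
Charging (`3A + #{0<d<6} ≤ 2b + #{d=0}`), Euler (`b + Z ≤ A + n`,
`Z ≥ #{d = 0} + [∃ d > 0]`) and `b + L = 3n`. [cite: DavoliPiovanoStefanelli2017, (60)–(62) p. 645] -/
theorem card_bdLayer_add_three_le {S : Finset (ℤ × ℤ)} (hne : S.Nonempty) (hconv : IsTriConvex S) :
    (bdLayer S).card + 3 ≤ lineCount S + (if S.card = 1 then 1 else 0) := by
  classical
  set iso := S.filter fun p => (S.filter (Adj p)).card = 0 with hiso
  set mid := S.filter fun p => 0 < (S.filter (Adj p)).card ∧ (S.filter (Adj p)).card < 6 with hmid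
  have hL := bondCount_add_lineCount hconv
  have hcharge := three_mul_triCount_add_card_le S
  rw [← hiso, ← hmid, adjCount_eq_two_mul_bondCount] at hcharge
  -- the boundary layer splits into `mid` and `iso`
  have hsplit : (bdLayer S).card = mid.card + iso.card := by
    have : bdLayer S = mid ∪ iso := by
      ext p
      rw [mem_bdLayer_iff_card, mem_union, hmid, hiso, mem_filter, mem_filter]
      constructor
      · rintro ⟨h1, h2⟩
        by_cases h : (S.filter (Adj p)).card = 0
        · exact Or.inr ⟨h1, h⟩
        · exact Or.inl ⟨h1, by omega, h2⟩
      · rintro (⟨h1, -, h2⟩ | ⟨h1, h2⟩)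
        · exact ⟨h1, h2⟩
        · exact ⟨h1, by omega⟩
    rw [this, card_union_of_disjoint]
    rw [hmid, hiso, disjoint_filter]
    intro p _ h1 h2
    omega
  by_cases hall : iso = S
  · -- every label isolated: `b = 0`, `L = 3n`, `∂S = S`
    have hb : bondCount S = 0 := by
      have h2 : adjCount S = 0 := by
        unfold adjCount
        refine sum_eq_zero fun p hp => ?_
        have : p ∈ iso := by rw [hall]; exact hp
        exact (mem_filter.1 this).2
      rw [adjCount_eq_two_mul_bondCount] at h2
      omega
    have hbd : (bdLayer S).card ≤ S.card := card_le_card (bdLayer_subset S)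
    have h1 : 1 ≤ S.card := hne.card_pos
    split_ifs with h <;> omega
  · -- some label has a neighbour: its top row and the isolated rows are bond-free upwards
    have hne' : (S.filter fun p => 0 < (S.filter (Adj p)).card).Nonempty := by
      rw [filter_nonempty_iff]
      by_contra hcon
      push Not at hcon
      apply hall
      rw [hiso]
      refine (filter_eq_self).2 fun p hp => ?_
      have := hcon p hp
      omega
    set T := (S.filter fun p => 0 < (S.filter (Adj p)).card).image Prod.snd with hT
    have hTne : T.Nonempty := hne'.image _
    set tstar := T.max' hTne with htstar
    obtain ⟨w, hw, hw2⟩ := mem_image.1 (T.max'_mem hTne)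
    rw [← htstar] at hw2
    rw [mem_filter] at hw
    have hEuler := bondCount_add_card_filter_rowBonds_eq_zero_le hconv.1
    -- the zero rows contain `insert tstar (iso.image Prod.snd)`
    have hmax : ∀ q ∈ S, 0 < (S.filter (Adj q)).card → q.2 ≤ tstar := by
      intro q hq hq0
      exact T.le_max' _ (mem_image.2 ⟨q, mem_filter.2 ⟨hq, hq0⟩, rfl⟩)
    have hpos : ∀ q ∈ S, ∀ q' ∈ S, Adj q q' → 0 < (S.filter (Adj q')).card := by
      intro q hq q' _ hqq'
      exact card_pos.2 ⟨q, mem_filter.2 ⟨hq, (adj_comm _ _).1 hqq'⟩⟩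
    have hstar0 : rowBonds S tstar = 0 := by
      unfold rowBonds
      rw [Nat.add_eq_zero_iff, card_eq_zero, card_eq_zero, filter_eq_empty_iff, filter_eq_empty_iff]
      constructor
      · intro m hm hm'
        rw [mem_row] at hm hm'
        have : 0 < (S.filter (Adj (m, tstar + 1))).card :=
          hpos _ hm _ hm' (by simp [Adj, normForm])
        have := hmax _ hm' this
        simp at this
      · intro m hm hm'
        rw [mem_row] at hm hm'
        have : 0 < (S.filter (Adj (m - 1, tstar + 1))).card :=
          hpos _ hm _ hm' (by simp [Adj, normForm])
        have := hmax _ hm' this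
        simp at this
    have hsub : insert tstar (iso.image Prod.snd) ⊆ (S.image Prod.snd).filter fun t => rowBonds S t = 0 := by
      intro t ht
      rw [mem_filter]
      rcases mem_insert.1 ht with rfl | ht
      · exact ⟨mem_image.2 ⟨w, hw.1, hw2⟩, hstar0⟩
      · obtain ⟨p, hp, rfl⟩ := mem_image.1 ht
        rw [hiso, mem_filter] at hp
        exact ⟨mem_image_of_mem _ hp.1, rowBonds_eq_zero_of_isolated hconv.1 hp.1 hp.2⟩
    have hinj : Set.InjOn Prod.snd (iso : Set (ℤ × ℤ)) := by
      intro p hp p' hp' h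
      rw [mem_coe, hiso, mem_filter] at hp hp'
      have h1 := row_eq_singleton_of_isolated hconv.1 hp.1 hp.2
      have h2 := row_eq_singleton_of_isolated hconv.1 hp'.1 hp'.2
      have h2' : row S p.2 = {p'.1} := by rw [show p.2 = p'.2 from h]; exact h2
      rw [h1, singleton_inj] at h2'
      exact Prod.ext h2' h
    have hnot : tstar ∉ iso.image Prod.snd := by
      intro ht
      obtain ⟨p, hp, hp2⟩ := mem_image.1 ht
      rw [hiso, mem_filter] at hp
      have h1 := row_eq_singleton_of_isolated hconv.1 hp.1 hp.2
      have hwrow : w.1 ∈ row S p.2 := by rw [mem_row, hp2, ← hw2]; obtain ⟨a, b⟩ := w; exact hw.1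
      rw [h1, mem_singleton] at hwrow
      have : w = p := Prod.ext hwrow (by rw [hw2, hp2])
      rw [this] at hw
      have := hw.2
      omega
    have hZ : iso.card + 1 ≤ ((S.image Prod.snd).filter fun t => rowBonds S t = 0).card := by
      calc iso.card + 1 = (insert tstar (iso.image Prod.snd)).card := by
            rw [card_insert_of_notMem hnot, card_image_of_injOn hinj]
        _ ≤ _ := card_le_card hsub
    have : (bdLayer S).card + 3 ≤ lineCount S := by omega
    split_ifs <;> omega

/-! ## §6 The discrete Bonnesen inequality -/

/-- **Hexagonal Bonnesen inequality (our sharper form of [DPS17, (71)]).**  For a non-empty 3-convex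
label set `S` with maximal inscribed hexagon radius `r` (`S ⊖ H_r ≠ ∅ = S ⊖ H_{r+1}`):
`#S + 3 (r+1)² ≤ (r+1) · L(S) + 1`, where `L(S)` is the number of lattice lines meeting `S`.
For an EIP minimizer `L(S) = ⌈√(12n−3)⌉ = p_n + 3` and this is `n ≤ −3r² + (p_n − 3)r + p_n + 1`
(equality for the full hexagons `H_s`).  Proof: `n = Σ_{t ≤ r} #∂(S ⊖ H_t)` and
`#∂(S ⊖ H_t) + 3 ≤ L(S) − 6t + [t = r]`. [cite: DavoliPiovanoStefanelli2017, Proposition 3.7 / (71) p. 651–652] -/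
theorem card_add_sq_le_lineCount {S : Finset (ℤ × ℤ)} (hconv : IsTriConvex S) {r : ℕ}
    (hr : (erodeN S r).Nonempty) (hr' : erodeN S (r + 1) = ∅) :
    S.card + 3 * (r + 1) ^ 2 ≤ (r + 1) * lineCount S + 1 := by
  -- `P(k)`: `#S + 3k² ≤ k L + #(S ⊖ H_k)` for `k ≤ r`, and with `+1` at `k = r + 1`
  have key : ∀ k, k ≤ r + 1 →
      S.card + 3 * k ^ 2 ≤ k * lineCount S + (erodeN S k).card + (if k = r + 1 then 1 else 0) := by
    intro k
    induction k with
    | zero => intro _; simp [erodeN_zero]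
    | succ k ih =>
      intro hk
      have hk' : k ≤ r := by omega
      have ih' := ih (by omega)
      rw [if_neg (by omega)] at ih'
      have hne : (erodeN S k).Nonempty := hr.mono (erodeN_antitone S hk')
      have hlayer := card_bdLayer_add_three_le hne (isTriConvex_erodeN hconv k)
      have hsplit := card_eq_card_erode_add_card_bdLayer (erodeN S k)
      rw [← erodeN_succ] at hsplit
      have hlines := lineCount_erodeN_add_le hne
      -- a single label only in the last non-empty erosion
      have hone : (if (erodeN S k).card = 1 then 1 else 0) ≤ (if k + 1 = r + 1 then 1 else 0) := by
        split_ifs with h1 h2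
        · exact le_rfl
        · exfalso
          have hlt : k < r := by omega
          have hne' : (erodeN S (k + 1)).Nonempty := hr.mono (erodeN_antitone S hlt)
          rw [erodeN_succ, erode_eq_empty_of_card_eq_one h1] at hne'
          exact not_nonempty_empty hne'
        · exact Nat.zero_le _
        · exact le_rfl
      have e : 3 * (k + 1) ^ 2 = 3 * k ^ 2 + (6 * k + 3) := by ring
      rw [e]
      have e2 : (k + 1) * lineCount S = k * lineCount S + lineCount S := by ring
      rw [e2]
      omega
  have := key (r + 1) le_rfl
  rw [if_pos rfl, hr', card_empty] at this
  omega

/-- **The `N^{3/4}`-law bookkeeping**: with `N_r = 3r² + 3r + 1 = #H_r` labels inside the maximal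
hexagon, `#S − N_r ≤ (r + 1)(L(S) − 6r − 3)` — the labels outside the maximal hexagon are at most
`r + 1` per extra lattice line (cf. [DPS17, (74)]: `|M_n ∖ H_{r_{M_n}}|`).
[cite: DavoliPiovanoStefanelli2017, (71) p. 652 and (74) p. 653] -/
theorem card_sub_le_of_isTriConvex {S : Finset (ℤ × ℤ)} (hconv : IsTriConvex S) {r : ℕ}
    (hr : (erodeN S r).Nonempty) (hr' : erodeN S (r + 1) = ∅) :
    S.card + (r + 1) * (6 * r + 3) ≤ (3 * r ^ 2 + 3 * r + 1) + (r + 1) * lineCount S := by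
  have := card_add_sq_le_lineCount hconv hr hr'
  nlinarith

/-- The line count of a set containing a translate of `H_r` is at least `6r + 3`.
[cite: DavoliPiovanoStefanelli2017, (62) p. 645] -/
theorem six_mul_add_three_le_lineCount {S : Finset (ℤ × ℤ)} {r : ℕ} (hr : (erodeN S r).Nonempty) :
    6 * r + 3 ≤ lineCount S := by
  have h1 := lineCount_erodeN_add_le hr
  have h2 : 3 ≤ lineCount (erodeN S r) := by
    obtain ⟨p, hp⟩ := hr
    unfold lineCount
    have a : 1 ≤ ((erodeN S r).image Prod.snd).card := card_pos.2 ⟨_, mem_image_of_mem _ hp⟩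
    have b : 1 ≤ (((erodeN S r).image rot6).image Prod.snd).card :=
      card_pos.2 ⟨_, mem_image_of_mem _ (mem_image_of_mem _ hp)⟩
    have c : 1 ≤ ((((erodeN S r).image rot6).image rot6).image Prod.snd).card :=
      card_pos.2 ⟨_, mem_image_of_mem _ (mem_image_of_mem _ (mem_image_of_mem _ hp))⟩
    omega
  omega

end HarborthSpiral

end Literature.Geometry.DiscreteGeometry

end
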